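import Literature.NumberTheory.EllipticCurves.LeadingTermPPartProofs
import HarnessLib

/-!
# The period ratio `ϖ = Ω⁺_f / Ω(E) ∈ ℚ_{>0}` for ANY newform `f` of an elliptic curve `E/ℚ`
# (any level), from the two catalogued facts «modular parametrisation datum» + «Carayol»

For an elliptic curve `E/ℚ` on a globally minimal model `W` and a weight-`2` cusp form
`f ∈ S₂(Γ₀(N))` with `IsNewformOf W f` (the normalised newform whose `q`-expansion is `L(W, s)`),
there is a rational `ϖ > 0` with `ϖ · Ω(W) = Ω⁺_f`, where `Ω(W) = W.realPeriodRat = ∫_{E(ℝ)}|ω|`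
and `Ω⁺_f = plusPeriod f` (real period of the period lattice `Λ_f`, number of real components
included). This is the scalar relating the tree's `p`-adic `L`-function `padicLFunction f α`
(normalised by `Ω⁺_f`) to the Mazur–Swinnerton-Dyer / Mazur–Tate–Teitelbaum one (normalised by
the Néron period of `E`), the `ϖ` of `PAdicBSD`, of `Wuthrich2014.charIdeal_dvd_padicLFunction` and of
`GreenbergVatsal2000.nonPrimitive_unitContent_and_lambda_eq_residual_of_lineRamifiedEven(_goodOrd)`.

PROVENANCE. Nothing new is asserted: the statement is DERIVED from two named facts already in the
tree — `nonempty_modularParametrizationData` (file `ModularCurve`; Breuil–Conrad–Diamond–Taylor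
2001 Thm. A with the Néron-lattice parametrisation datum: newform `D.f` of level `N_W`, Manin
constant `c ≠ 0`, `c · Λ_f ⊆ Λ_E`) and `IsNewformOf.level_eq_conductorNorm` (file
`CuspFormLFunction`; Carayol 1986: the level of the newform of `W` is `N_W`) — through the theorem
`ModularParametrizationData.exists_rat_mul_realPeriodRat_eq_plusPeriod` (file
`LeadingTermPPartProofs`; Edixhoven 1991 §1, `m · Ω(W) = |c| · Ω⁺_f`) and the `q`-expansion
uniqueness `IsNewformOf.unique`. The only work here is to move from the datum's own newform `D.f`
at level `N_W` to an ARBITRARY `f : CuspForm (Gamma0 N) 2` with `IsNewformOf W f`, which is the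
shape in which consumers quantify (e.g. the inline period clause (iv) of the print pack
`Summit.…Theses.EisensteinCountDoorRankTwo.PublishedInputs`, item stmt-BirchSwinnertonDyer-23554,
and the non-vacuity hypothesis of `matsuno2008_prop65_charIdeal_quadraticTwist_two`).

In print: Cremona, *Algorithms for Modular Elliptic Curves* (2nd ed. 1997) §2.8 (the period
lattice `Λ_f` of a rational newform is the lattice of the optimal curve scaled by the Manin
constant; any curve of the isogeny class has commensurable real period); Edixhoven 1991 §1
(`φ^*ω_E = c · 2πi f dτ`, `c ∈ ℤ ∖ {0}`); Carayol 1986 / Diamond–Shurman Thm. 8.8.1 (level =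
conductor). [cite: EdixhovenManin1991, §1] [cite: Carayol1986] [cite: CremonaAlgorithms1997, §2.8]
-/

set_option autoImplicit false

noncomputable section

open scoped MatrixGroups ModularForm

open CongruenceSubgroup WeierstrassCurve

namespace Literature.NumberTheory.EllipticCurves.ModularForms

/-- **`ϖ = Ω⁺_f / Ω(W)` is a positive rational, for every newform `f` of `W` at any level.**
From the parametrisation fact `nonempty_modularParametrizationData` (datum `D` at level `N_W`,
`ϖ_D > 0` with `ϖ_D · Ω(W) = Ω⁺_{D.f}` by
`ModularParametrizationData.exists_rat_mul_realPeriodRat_eq_plusPeriod`) and Carayol's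
`IsNewformOf.level_eq_conductorNorm` (`N = N_W`), whence `f = D.f` by `q`-expansion uniqueness
(`IsNewformOf.unique`). [cite: EdixhovenManin1991, §1] [cite: Carayol1986] -/
theorem exists_pos_rat_mul_realPeriodRat_eq_plusPeriod_of_facts
    (h₁ : nonempty_modularParametrizationData) {N : ℕ} [NeZero N]
    (h₂ : IsNewformOf.level_eq_conductorNorm (N := N))
    (W : WeierstrassCurve ℚ) [W.IsElliptic] [W.IsGloballyMinimal]
    (f : CuspForm (Gamma0 N) 2) (hf : IsNewformOf W f) :
    ∃ ϖ : ℚ, 0 < ϖ ∧ (ϖ : ℝ) * W.realPeriodRat = plusPeriod f := by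
  have hN : N = W.conductorNorm ℤ := h₂ hf
  subst hN
  obtain ⟨D⟩ := h₁ W
  have hfD : f = D.f := hf.unique D.isNewformOf
  obtain ⟨ϖ, hϖ, hϖeq, -⟩ := D.exists_rat_mul_realPeriodRat_eq_plusPeriod
  exact ⟨ϖ, hϖ, hfD ▸ hϖeq⟩

/-- **The same in the shape `∃ ϖ ≠ 0`** — verbatim the period clause (iv) of the print pack
`PublishedInputs` of route `EisensteinCountDoorRankTwo` (item stmt-BirchSwinnertonDyer-23554):
`∀ W f, IsNewformOf W f → ∃ ϖ : ℚ, ϖ ≠ 0 ∧ (ϖ : ℝ) * W.realPeriodRat = plusPeriod f`, so that this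
clause is a CONSEQUENCE of the two catalogued facts `nonempty_modularParametrizationData` and
`IsNewformOf.level_eq_conductorNorm` rather than an independent print input.
[cite: EdixhovenManin1991, §1] [cite: Carayol1986] -/
theorem exists_ne_zero_rat_mul_realPeriodRat_eq_plusPeriod_of_facts
    (h₁ : nonempty_modularParametrizationData)
    (h₂ : ∀ {N : ℕ} [NeZero N], IsNewformOf.level_eq_conductorNorm (N := N))
    (W : WeierstrassCurve ℚ) [W.IsElliptic] [W.IsGloballyMinimal] {N : ℕ} [NeZero N]
    (f : CuspForm (Gamma0 N) 2) (hf : IsNewformOf W f) :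
    ∃ ϖ : ℚ, ϖ ≠ 0 ∧ (ϖ : ℝ) * W.realPeriodRat = plusPeriod f := by
  obtain ⟨ϖ, hϖ, hϖeq⟩ := exists_pos_rat_mul_realPeriodRat_eq_plusPeriod_of_facts h₁ h₂ W f hf
  exact ⟨ϖ, hϖ.ne', hϖeq⟩

end Literature.NumberTheory.EllipticCurves.ModularForms

end
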